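import Summits.BirchSwinnertonDyer.BirchSwinnertonDyer.Theorems.GenusKolyvaginAtTwoGenusPrimitiveSupplyAtTwoKramerTwistParity
import Summits.BirchSwinnertonDyer.BirchSwinnertonDyer.Theorems.GenusKolyvaginAtTwoCasselsTatePTcRealReadout
import Literature.NumberTheory.EllipticCurves.CasselsTateAlternating
import Summits.BirchSwinnertonDyer.BirchSwinnertonDyer.Theorems.GenusKolyvaginAtTwoMazurRubinCor34iiDictionary
import Literature.NumberTheory.EllipticCurves.BSDSelmerParityMonskyProofs
import Literature.NumberTheory.EllipticCurves.BSDSelmerParityDokchitserBaseChangeProofs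
import Literature.NumberTheory.EllipticCurves.QuadraticTwistSelmerPInfty
import Literature.NumberTheory.EllipticCurves.QuadraticTwistJInvariantProofs
import Literature.NumberTheory.EllipticCurves.GlobalMinimalModelProofs
import Literature.NumberTheory.EllipticCurves.RootNumberSmulProofs
import Literature.NumberTheory.EllipticCurves.SelmerGroupCardinality
import Literature.NumberTheory.EllipticCurves.TwoSelmerRankQuadraticParity
import HarnessLib

/-!
# Route `GenusKolyvaginAtTwo`, crux #2 `GenusPrimitiveSupplyAtTwo` (stmt-BirchSwinnertonDyer-22136):
# MONSKY 1996 LEMMA 1.4(b) = THE NAMED FACT `h14` DISCHARGED — `rank E(K) + dim Ш(E/K)[2] ≡ r₂(K) (mod 2)` for a quadratic `K` in which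
# `2` and `N_E` split (Kramer 1981 Thm. 1 + Thm. 2 / Monsky 1996 Lemma 1.4(b), `F = ℚ`)

Width seat `bsd-line-gk2-p5` g19 (cell `bsd-f1-sign2`, SUPPLY lineage of crux 22136), file 58 of the series; sequel of files 56/57
(`…KramerLocalIndices`, `…KramerTwistParity`). THEOREMS ONLY (no definition, no named fact, no `sorry`); helper `--supports stmt-BirchSwinnertonDyer-22136`;
no item is closed; BSD is not proved by any of this.

THE ROAD (every stone a tree theorem; Kramer's Theorem 2 — the alternating pairing on `Φ/NS'` — is NOT formalised, its rôle is played by the Cassels–Tate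
pairing over `K` and over `ℚ` and by the Poonen–Rains form of Kramer's congruence):
(1) `rank E(K) + dim Ш(E/K)[2] ≡ rk₂(E/K) (mod 2)` — Cassels–Tate over `K` (`mordellWeilRank_add_mod_two_eq_selmerCorank_of_casselsTate` fed with
    gk2-p1's `WeierstrassCurve.exists_casselsTate_pairing_holds`, whose two-line assembly is re-run inline to keep this file off the route file's import cone);
(2) `rk₂(E/K) = rk₂(E) + rk₂(E^{(d_K)})` — `selmerCorank_baseChange_quadratic_holds` (Dokchitser–Dokchitser 2010 Lemma 4.14);
(3) `rk₂(V) ≡ d₂(V) + dim V(ℚ)[2] (mod 2)` for `V = E, E^{(d_K)}` — Cassels–Tate over `ℚ` + the Kummer count `#Sel₂ = 2^{rank}·#V(ℚ)[2]·#Ш[2]`, and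
    `#E^{(d)}(ℚ)[2] = #E(ℚ)[2]`;
(4) `d₂(E) + d₂(E^{(d_K)}) ≡ [d_K < 0] (mod 2)` — file 57 (`card_selmerGroup_add_twist_mod_two`: Kramer's congruence via Poonen–Rains with the local indices
    computed, for a globally minimal model; any model by `selmerCorank_eq_of_variableChange`, `conductorNorm_smul`);
(5) `r₂(K) = [d_K < 0]`.

* `mordellWeilRank_baseChange_add_mod_two_eq_card_selmerGroup_add` — **Mazur–Rubin Lemma 2.5 over ℚ, unconditionally**: for EVERY quadratic `K`,
  `rank W(K) + dim Ш(W/K)[2] ≡ d₂(W) + d₂(W^{(d_K)}) (mod 2)`;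
* `selmerCorank_add_twist_mod_two` — **`rk₂(W) + rk₂(W^{(d_K)}) ≡ [d_K < 0] (mod 2)`** for EVERY elliptic `W/ℚ` and `K` quadratic with `2`, `N_W` split;
* **`Monsky1996_lemma14b_twoSelmerRank_parity_holds : Monsky1996_lemma14b_twoSelmerRank_parity`** — the named fact of
  `Literature/NumberTheory/EllipticCurves/TwoSelmerRankQuadraticParity.lean`, PROVED. Consequences (next file): this lineage's rows G′/X/M (files 52–54) lose
  their hypothesis `h14`, and Monsky's `2`-parity theorem over `ℚ` (`monsky_selmerCorank_two_mod_two_eq_of_kramer`) is left conditional on Modularity and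
  Gross–Zagier–Kolyvagin only.

References: [Monsky1996] Lemma 1.4(b), §2, Thm. 1.5; [Kramer1981] Thm. 1, Thm. 2, Props. 3, 6, Cor. 1; [MazurRubin2010] Thm. 2.7, Lemma 2.5;
[DokchitserDokchitserAnnals2010] Lemma 4.14; [Cassels1962ArithmeticIV]; [SilvermanAEC2009] X.4.2, X.4.14.
-/

set_option linter.dupNamespace false -- tree convention: `Summit.BirchSwinnertonDyer.BirchSwinnertonDyer.Theorems` (summit = sub-problem)
set_option autoImplicit false

noncomputable section

open scoped Classical AddSubgroup

namespace Summit.BirchSwinnertonDyer.BirchSwinnertonDyer.Theorems.GenusKolyArch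

open WeierstrassCurve NumberField
open Literature.NumberTheory.EllipticCurves

/-! ## §1 `rk₂(W) + rk₂(W^{(d_K)}) ≡ [d_K < 0] (mod 2)` -/

section Corank

variable (K : Type) [Field K] [NumberField K]

/-- **`rk₂(V) + rk₂(V^{(d)}) ≡ s + s' (mod 2)` where `#Sel₂(V) = 2^s`, `#Sel₂(V^{(d)}) = 2^{s'}`** (any elliptic `V/ℚ`, `d ≠ 0`):
Cassels–Tate over `ℚ` (`rank + dim Ш[2] ≡ rk₂`, `mordellWeilRank_add_mod_two_eq_selmerCorank_of_casselsTate` with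
`exists_casselsTate_pairing_holds`), the Kummer count `#Sel₂ = 2^{rank} · #V(ℚ)[2] · #Ш[2]` (`card_selmerGroup_eq_pow_rank_mul`) and
`#V^{(d)}(ℚ)[2] = #V(ℚ)[2]` (`natCard_torsionBy_two_quadraticTwist`). [cite: SilvermanAEC2009, Thm X.4.2(a)] [cite: Cassels1962ArithmeticIV]
[cite: Monsky1996, p. 416] [cite: MazurRubin2010, Lemma 2.5] -/
theorem selmerCorank_add_twist_mod_two_of_cards (V : WeierstrassCurve ℚ) [V.IsElliptic] {d : ℚ} (hd : d ≠ 0) {s s' : ℕ}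
    (hs : Nat.card (V.selmerGroup ((2 : ℕ) : ℤ)) = 2 ^ s)
    (hs' : haveI := V.isElliptic_quadraticTwist hd; Nat.card ((V.quadraticTwist d).selmerGroup ((2 : ℕ) : ℤ)) = 2 ^ s') :
    haveI := V.isElliptic_quadraticTwist hd
    (V.selmerCorank 2 + (V.quadraticTwist d).selmerCorank 2) % 2 = (s + s') % 2 := by
  haveI := V.isElliptic_quadraticTwist hd
  haveI : Fact (Nat.Prime 2) := ⟨Nat.prime_two⟩
  -- the Cassels–Tate theorem over `ℚ` (gk2-p1 g13's two-line assembly `exists_casselsTate_pairing_holds`, re-run inline to stay off the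
  -- route file's import cone): levelwise PT pairing + the even-level theta datum
  have hCTK : WeierstrassCurve.exists_casselsTate_pairing (K := ℚ) :=
    GenusExact.CasselsTatePTcReal.exists_casselsTate_pairing_of_levelThetaDatum (K := ℚ)
      fun W _ k hk _ e hμ hadd₁ hadd₂ _hgal halt _hnd ↦
        ⟨levelThetaDatumEven W (2 ^ k) e hμ hadd₁ hadd₂ halt (Nat.even_pow.mpr ⟨even_two, hk.ne'⟩)⟩
  obtain ⟨u, hu⟩ := exists_natCard_shaTorsionBy_eq_pow V 2
  obtain ⟨u', hu'⟩ := exists_natCard_shaTorsionBy_eq_pow (V.quadraticTwist d) 2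
  have hCT := mordellWeilRank_add_mod_two_eq_selmerCorank_of_casselsTate hCTK V 2 hu
  have hCT' := mordellWeilRank_add_mod_two_eq_selmerCorank_of_casselsTate hCTK
    (V.quadraticTwist d) 2 hu'
  have hc := card_selmerGroup_eq_pow_rank_mul V 2
  have hc' := card_selmerGroup_eq_pow_rank_mul (V.quadraticTwist d) 2
  rw [GenusKolyArch.natCard_sha_inf_torsionBy_eq V 2, hs, hu] at hc
  rw [GenusKolyArch.natCard_sha_inf_torsionBy_eq (V.quadraticTwist d) 2, hs', hu'] at hc'
  -- `#V^{(d)}(ℚ)[2] = #V(ℚ)[2]`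
  have htw := GenusKolyTwistTamagawa.natCard_torsionBy_two_quadraticTwist V hd
  simp only [Nat.cast_ofNat] at hc hc'
  rw [htw] at hc'
  -- `#V(ℚ)[2]` divides `2^s`, hence is a power of two
  obtain ⟨t, -, ht⟩ := (Nat.dvd_prime_pow Nat.prime_two).mp ((dvd_mul_left _ _).trans (Dvd.intro _ hc.symm))
  rw [ht, ← pow_add, ← pow_add] at hc hc'
  have he : s = V.mordellWeilRank + t + u := Nat.pow_right_injective le_rfl hc
  have he' : s' = (V.quadraticTwist d).mordellWeilRank + t + u' := Nat.pow_right_injective le_rfl hc'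
  rw [Nat.add_mod, ← hCT, ← hCT', ← Nat.add_mod, he, he']
  omega

/-- **MAZUR–RUBIN LEMMA 2.5 / MONSKY LEMMA 1.2 OVER A QUADRATIC FIELD, UNCONDITIONALLY**: for every elliptic `W/ℚ` and EVERY quadratic field `K`
(discriminant `d_K`, no splitting hypothesis), `rank W(K) + dim_{𝔽₂} Ш(W/K)[2] ≡ d₂(W) + d₂(W^{(d_K)}) (mod 2)` — Cassels–Tate over `K`
(`exists_casselsTate_pairing_holds`), `rk₂(W/K) = rk₂(W) + rk₂(W^{(d_K)})` (`selmerCorank_baseChange_quadratic_holds`) and the previous theorem.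
[cite: MazurRubin2010, Lemma 2.5] [cite: Monsky1996, Lemma 1.2 (p. 416)] [cite: Kramer1981, Thm. 1 and Thm. 2] -/
theorem mordellWeilRank_baseChange_add_mod_two_eq_card_selmerGroup_add (W : WeierstrassCurve ℚ) [W.IsElliptic] (h2 : Module.finrank ℚ K = 2)
    {u s s' : ℕ} (hu : Nat.card (((W.baseChange K).sha)[(2 : ℤ)]) = 2 ^ u) (hs : Nat.card (W.selmerGroup ((2 : ℕ) : ℤ)) = 2 ^ s)
    (hs' : haveI := W.isElliptic_quadraticTwist (show ((NumberField.discr K : ℤ) : ℚ) ≠ 0 by exact_mod_cast NumberField.discr_ne_zero K)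
      Nat.card ((W.quadraticTwist (NumberField.discr K : ℚ)).selmerGroup ((2 : ℕ) : ℤ)) = 2 ^ s') :
    ((W.baseChange K).mordellWeilRank + u) % 2 = (s + s') % 2 := by
  have hd0 : ((NumberField.discr K : ℤ) : ℚ) ≠ 0 := by exact_mod_cast NumberField.discr_ne_zero K
  haveI := W.isElliptic_quadraticTwist hd0
  haveI : Fact (Nat.Prime 2) := ⟨Nat.prime_two⟩
  haveI : (W.baseChange K).IsElliptic := inferInstanceAs ((W.map (algebraMap ℚ K)).IsElliptic)
  -- the Cassels–Tate theorem over `K` (gk2-p1 g13's two-line assembly `exists_casselsTate_pairing_holds`, re-run inline to stay off the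
  -- route file's import cone): levelwise PT pairing + the even-level theta datum
  have hCTK : WeierstrassCurve.exists_casselsTate_pairing (K := K) :=
    GenusExact.CasselsTatePTcReal.exists_casselsTate_pairing_of_levelThetaDatum (K := K)
      fun W _ k hk _ e hμ hadd₁ hadd₂ _hgal halt _hnd ↦
        ⟨levelThetaDatumEven W (2 ^ k) e hμ hadd₁ hadd₂ halt (Nat.even_pow.mpr ⟨even_two, hk.ne'⟩)⟩
  have hu' : Nat.card (AddSubgroup.torsionBy (↥(W.baseChange K).sha) ((2 : ℕ) : ℤ)) = 2 ^ u := hu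
  rw [mordellWeilRank_add_mod_two_eq_selmerCorank_of_casselsTate hCTK (W.baseChange K) 2 hu',
    selmerCorank_baseChange_quadratic_holds W K h2 2, selmerCorank_add_twist_mod_two_of_cards W hd0 hs hs']

/-- **`rk₂(W) + rk₂(W^{(d_K)}) ≡ [d_K < 0] (mod 2)` for EVERY elliptic `W/ℚ`** and every quadratic `K` in which `2` and every prime of `N_W` split
(Kramer's congruence with the local indices computed, file 57, for a globally minimal model of `W`; Cassels–Tate over `ℚ`; `#W^{(d)}(ℚ)[2] = #W(ℚ)[2]`;
isomorphism invariance of `rk₂` and of `N_W`). [cite: Kramer1981, Thm. 1, Thm. 2, Cor. 1] [cite: Monsky1996, §2] [cite: MazurRubin2010, Thm. 2.7] -/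
theorem selmerCorank_add_twist_mod_two (W : WeierstrassCurve ℚ) [W.IsElliptic] (h2 : Module.finrank ℚ K = 2)
    (hH2 : SatisfiesHeegnerHypothesis 2 K) (hHN : SatisfiesHeegnerHypothesis (W.conductorNorm ℤ) K) :
    haveI := W.isElliptic_quadraticTwist (show ((NumberField.discr K : ℤ) : ℚ) ≠ 0 by exact_mod_cast NumberField.discr_ne_zero K)
    (W.selmerCorank 2 + (W.quadraticTwist (NumberField.discr K : ℚ)).selmerCorank 2) % 2 = if NumberField.discr K < 0 then 1 else 0 := by
  set d : ℤ := NumberField.discr K with hd_def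
  have hd0 : (d : ℚ) ≠ 0 := by exact_mod_cast NumberField.discr_ne_zero K
  haveI := W.isElliptic_quadraticTwist hd0
  haveI : Fact (Nat.Prime 2) := ⟨Nat.prime_two⟩
  -- a globally minimal model `W₀ = C • W`
  obtain ⟨C, hC⟩ := hasGlobalMinimalModel_rat_holds W
  haveI := hC
  haveI : (C • W).IsElliptic := inferInstance
  haveI h0d := (C • W).isElliptic_quadraticTwist hd0
  have e1 : W.selmerCorank 2 = (C • W).selmerCorank 2 := selmerCorank_eq_of_variableChange 2 (rfl : C • W = C • W)
  have e2 : (W.quadraticTwist (d : ℚ)).selmerCorank 2 = ((C • W).quadraticTwist (d : ℚ)).selmerCorank 2 :=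
    selmerCorank_eq_of_variableChange 2 (quadraticTwist_smul W C (d : ℚ)).symm
  have hHN0 : SatisfiesHeegnerHypothesis ((C • W).conductorNorm ℤ) K := by rwa [conductorNorm_smul]
  rw [e1, e2]
  -- the parity for the minimal model
  obtain ⟨s, s', hs, hs', hpar⟩ := card_selmerGroup_add_twist_mod_two (C • W) K h2 hH2 hHN0 (one_smul _ ((C • W).quadraticTwist (d : ℚ)))
  rw [selmerCorank_add_twist_mod_two_of_cards (C • W) hd0 hs hs', hpar]

end Corank

/-! ## §2 Monsky 1996 Lemma 1.4(b) — the named fact `h14` proved -/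

/-- **MONSKY 1996, LEMMA 1.4(b) (`F = ℚ`) — the tree's named fact `Monsky1996_lemma14b_twoSelmerRank_parity` PROVED**: for an elliptic `W/ℚ` (any
model) and a quadratic field `K` in which `2` and every prime of the conductor `N_W` split, `rank W(K) + dim_{𝔽₂} Ш(W/K)[2] ≡ r₂(K) (mod 2)`.
Proof: (1) Cassels–Tate over `K`: `rank + dim Ш[2] ≡ rk₂(W/K)`; (2) `rk₂(W/K) = rk₂(W) + rk₂(W^{(d_K)})`; (3)–(4) `selmerCorank_add_twist_mod_two`;
(5) `r₂(K) = [d_K < 0]`. [cite: Monsky1996, Lemma 1.4(b) (p. 417) and §2] [cite: Kramer1981, Thm. 1, Thm. 2 and Prop. 3]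
[cite: DokchitserDokchitserAnnals2010, Lemma 4.14] [cite: Cassels1962ArithmeticIV] -/
theorem Monsky1996_lemma14b_twoSelmerRank_parity_holds : Monsky1996_lemma14b_twoSelmerRank_parity := by
  intro W _ K _ _ h2 hH2 hHN u hu
  haveI : Fact (Nat.Prime 2) := ⟨Nat.prime_two⟩
  haveI : (W.baseChange K).IsElliptic := inferInstanceAs ((W.map (algebraMap ℚ K)).IsElliptic)
  -- the Cassels–Tate theorem over `K` (gk2-p1 g13's two-line assembly `exists_casselsTate_pairing_holds`, re-run inline to stay off the
  -- route file's import cone): levelwise PT pairing + the even-level theta datum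
  have hCTK : WeierstrassCurve.exists_casselsTate_pairing (K := K) :=
    GenusExact.CasselsTatePTcReal.exists_casselsTate_pairing_of_levelThetaDatum (K := K)
      fun W _ k hk _ e hμ hadd₁ hadd₂ _hgal halt _hnd ↦
        ⟨levelThetaDatumEven W (2 ^ k) e hμ hadd₁ hadd₂ halt (Nat.even_pow.mpr ⟨even_two, hk.ne'⟩)⟩
  -- (1) Cassels–Tate over `K`
  have hu' : Nat.card (AddSubgroup.torsionBy (↥(W.baseChange K).sha) ((2 : ℕ) : ℤ)) = 2 ^ u := hu
  have h1 := mordellWeilRank_add_mod_two_eq_selmerCorank_of_casselsTate hCTK (W.baseChange K) 2 hu'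
  rw [h1, selmerCorank_baseChange_quadratic_holds W K h2 2, selmerCorank_add_twist_mod_two K W h2 hH2 hHN]
  -- (5) `r₂(K) = [d_K < 0]`
  split_ifs with hd
  · rw [(Literature.NumberTheory.QuadraticFields.Quadratic.nrRealPlaces_eq_zero_and_nrComplexPlaces_eq_one h2 hd).2]
  · have hpos : 0 < NumberField.discr K := lt_of_le_of_ne (not_lt.mp hd) (Ne.symm (NumberField.discr_ne_zero K))
    rw [(Literature.NumberTheory.QuadraticFields.Quadratic.nrRealPlaces_eq_two_and_nrComplexPlaces_eq_zero h2 hpos).2]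

end Summit.BirchSwinnertonDyer.BirchSwinnertonDyer.Theorems.GenusKolyArch

end
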